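import Mathlib
import Summits.Ventures.PercRepro2.HCov
import Summits.Ventures.PercRepro2.BHKOutside
import Summits.Ventures.PercRepro2.FirstOrderTerms
import Summits.Ventures.PercRepro2.FirstOrderSlope

/-!
# The `b`-slope of the pendant-root form at the closed centering is non-negative, and the two
Harris bounds on the worlds (blind cell PercRepro2, p5 g22; `proofs/P5-OEDGE.md` §28)

For an instance `(o, a₁, a₂, a₃, b)` with `Q = {a₁ ↮ a₂}`, `T = {a₁ ↮ a₂, a₃ ∈ C₂}` (`TEvent`),
`β = P(b ↔ a₁)` (`FirstOrder.beta`), `D₀ = P(a₃ ∉ C₁)`: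

* **`T_clusterIn_mul_Q_le`**: `P(T, C₁ ∈ 𝓥) · P(Q) ≤ P(T) · P(Q, C₁ ∈ 𝓥)` for every up-set `𝓥` of `C₁`
  (BHK06 Thm 1.4, `bhk_cross_cluster_avoid`, `s = a₂`, `t = a₁`, `X = {a₁}`, `𝓤 = {a₃ ∈ ·}`);
* **`Q_clusterIn_le_mul`**: `P(Q, C₁ ∈ 𝓥) ≤ P(Q) · P(C₁ ∈ 𝓥)` (Harris: `Q` decreasing);
* **`T_bL_le_beta_mul`**: `P(T, b ∈ C₁) ≤ β · P(T)` — `P(b ∈ C₁ | T) ≤ β`;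
* **`slopeG0_nonneg`**: `0 ≤ slopeG0 := P(Q∖T′, b ∈ C₂) + P(T)·β − P(T, b ∈ C₁)` — the `g`-derivative
  `∂_gΨ(β)` of the bilinear pendant-root form at the closed centering `β` (P5-OEDGE §27 addendum 2);
* **`Q_avoid_a3_ge`**: `P(Q) · D₀ ≤ P(Q, a₃ ∉ C₁) = P(PD) + P(T)` (Harris: both decreasing) — the sign
  of `D − Q·D₀` is bounded below by `−P(T)`.
-/

namespace Summit.Ventures.PercRepro2

open UnionCluster

namespace CovForm

namespace FirstOrder

section Sets

variable {V : Type*} {E : Type*}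

/-- `T ∩ {C₁ ∈ 𝓥} = {a₃ ∈ C(a₂)} ∩ {C₁ ∈ 𝓥} ∩ {a₂ ↮ a₁}`. -/
lemma TEvent_inter_clusterIn_eq' (ends : E → Sym2 V) (a₁ a₂ a₃ : V) (𝓥 : Set (Set V)) :
    TEvent ends a₁ a₂ a₃ ∩ clusterInEvent ends a₁ 𝓥 =
      clusterInEvent ends a₂ {W | a₃ ∈ W} ∩ clusterInEvent ends a₁ 𝓥 ∩ avoidAll ends a₂ {a₁} := by
  ext ω
  simp only [TEvent, Set.mem_inter_iff, Set.mem_compl_iff, mem_connEvent, mem_clusterInEvent,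
    Set.mem_setOf_eq, mem_cluster, mem_avoidAll, Finset.mem_singleton, forall_eq]
  tauto

/-- `T = {a₃ ∈ C(a₂)} ∩ {a₂ ↮ a₁}`. -/
lemma TEvent_eq_clusterIn_inter_avoid' (ends : E → Sym2 V) (a₁ a₂ a₃ : V) :
    TEvent ends a₁ a₂ a₃ = clusterInEvent ends a₂ {W | a₃ ∈ W} ∩ avoidAll ends a₂ {a₁} := by
  ext ω
  simp only [TEvent, Set.mem_inter_iff, Set.mem_compl_iff, mem_connEvent, mem_clusterInEvent,
    Set.mem_setOf_eq, mem_cluster, mem_avoidAll, Finset.mem_singleton, forall_eq]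
  tauto

/-- `{a₂ ↮ a₁}` is a decreasing event. -/
lemma isLowerSet_avoidAll_singleton' (ends : E → Sym2 V) (a₂ a₁ : V) :
    IsLowerSet (avoidAll ends a₂ {a₁}) := by
  intro ω ω' h hω y hy hc
  exact hω y hy (conn_mono h hc)

end Sets

section Main

variable {V : Type*} {E : Type*} [Fintype E] [DecidableEq E] [Fintype V] [DecidableEq V]
  {R : Type*} [Field R] [LinearOrder R] [IsStrictOrderedRing R]

/-- **`P(T, C₁ ∈ 𝓥) · P(Q) ≤ P(T) · P(Q, C₁ ∈ 𝓥)`** for every up-set `𝓥` of `C₁` (BHK06 Thm 1.4,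
`bhk_cross_cluster_avoid`, `s = a₂`, `t = a₁`, `X = {a₁}`, `𝓤 = {a₃ ∈ ·}`): on `Q` the increasing
event `a₃ ∈ C₂` and `C₁ ∈ 𝓥` are negatively correlated. -/
theorem T_clusterIn_mul_Q_le (p : E → R) (hp : IsProbVec p) (ends : E → Sym2 V) (a₁ a₂ a₃ : V)
    {𝓥 : Set (Set V)} (h𝓥 : IsUpperSet 𝓥) :
    prob p (TEvent ends a₁ a₂ a₃ ∩ clusterInEvent ends a₁ 𝓥) * prob p (avoidAll ends a₂ {a₁}) ≤
      prob p (TEvent ends a₁ a₂ a₃) * prob p (clusterInEvent ends a₁ 𝓥 ∩ avoidAll ends a₂ {a₁}) := by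
  have h := bhk_cross_cluster_avoid p hp ends a₂ a₁ (Finset.mem_singleton_self a₁)
    (isUpperSet_mem_setOf a₃) h𝓥
  rw [TEvent_inter_clusterIn_eq', TEvent_eq_clusterIn_inter_avoid']
  exact h

omit [Fintype V] [DecidableEq V] in
/-- **Harris**: `P(Q, C₁ ∈ 𝓥) ≤ P(Q) · P(C₁ ∈ 𝓥)` for an up-set `𝓥` (`Q` is decreasing). -/
theorem Q_clusterIn_le_mul (p : E → R) (hp : IsProbVec p) (ends : E → Sym2 V) (a₁ a₂ : V)
    {𝓥 : Set (Set V)} (h𝓥 : IsUpperSet 𝓥) :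
    prob p (clusterInEvent ends a₁ 𝓥 ∩ avoidAll ends a₂ {a₁}) ≤
      prob p (avoidAll ends a₂ {a₁}) * prob p (clusterInEvent ends a₁ 𝓥) := by
  rw [Set.inter_comm]
  exact prob_inter_le_prob_mul_prob_of_isLowerSet hp (isLowerSet_avoidAll_singleton' ends a₂ a₁)
    (isUpperSet_clusterInEvent ends a₁ h𝓥)

/-- **`P(T, b ∈ C₁) ≤ β · P(T)`**: `P(b ∈ C₁ | T) ≤ β = P(b ↔ a₁)`. -/
theorem T_bL_le_beta_mul (p : E → R) (hp : IsProbVec p) (ends : E → Sym2 V) (a₁ a₂ a₃ b : V) :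
    prob p (TEvent ends a₁ a₂ a₃ ∩ connEvent ends a₁ b) ≤
      beta p ends a₁ b * prob p (TEvent ends a₁ a₂ a₃) := by
  classical
  have h1 := T_clusterIn_mul_Q_le p hp ends a₁ a₂ a₃ (isUpperSet_mem_setOf b)
  have h2 := Q_clusterIn_le_mul p hp ends a₁ a₂ (isUpperSet_mem_setOf b)
  rw [← connEvent_eq_clusterInEvent ends a₁ b] at h1 h2
  unfold beta
  set Q := prob p (avoidAll ends a₂ {a₁}) with hQ
  set t := prob p (TEvent ends a₁ a₂ a₃) with ht
  set x := prob p (TEvent ends a₁ a₂ a₃ ∩ connEvent ends a₁ b) with hx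
  set β := prob p (connEvent ends a₁ b) with hβ
  have hQ0 : 0 ≤ Q := prob_nonneg hp _
  have ht0 : 0 ≤ t := prob_nonneg hp _
  have hβ0 : 0 ≤ β := prob_nonneg hp _
  -- `x ≤ t` and `t ≤ Q` (`T ⊆ Q`)
  have hxt : x ≤ t := prob_mono hp Set.inter_subset_left
  have htQ : t ≤ Q := by
    rw [ht, hQ, TEvent_eq_clusterIn_inter_avoid']
    exact prob_mono hp Set.inter_subset_right
  rcases eq_or_lt_of_le hQ0 with hQz | hQpos
  · -- `Q = 0`: then `t = 0` and `x = 0`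
    have htz : t = 0 := le_antisymm (hQz ▸ htQ) ht0
    have hxz : x = 0 := le_antisymm (htz ▸ hxt) (prob_nonneg hp _)
    rw [hxz, htz, mul_zero]
  · -- `x · Q ≤ t · P(Q, bL) ≤ t · Q · β`
    have h3 : x * Q ≤ t * (Q * β) := h1.trans (mul_le_mul_of_nonneg_left h2 ht0)
    have h4 : x * Q ≤ (β * t) * Q := by linarith [h3]
    exact le_of_mul_le_mul_right h4 hQpos

/-- **The cleared `b`-slope of the pendant-root form at the closed centering**:
`slopeG0 = P(Q∖T′, b ∈ C₂) + P(T)·β − P(T, b ∈ C₁)` (`= ∂_gΨ(β)` with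
`∂_gΨ(s) = P(Q∖T′, b ∈ C₂) − P(T, b ∈ C₁) + P(T)·s`, P5-OEDGE §27 addendum 2). -/
noncomputable def slopeG0 (p : E → R) (ends : E → Sym2 V) (a₁ a₂ a₃ b : V) : R :=
  prob p (avoidAll ends a₂ {a₁} ∩ (connEvent ends a₁ a₃)ᶜ ∩ connEvent ends a₂ b) +
    prob p (TEvent ends a₁ a₂ a₃) * beta p ends a₁ b -
    prob p (TEvent ends a₁ a₂ a₃ ∩ connEvent ends a₁ b)

/-- **`0 ≤ slopeG0`**: the `b`-slope `∂_gΨ(β)` is non-negative. -/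
theorem slopeG0_nonneg (p : E → R) (hp : IsProbVec p) (ends : E → Sym2 V) (a₁ a₂ a₃ b : V) :
    0 ≤ slopeG0 p ends a₁ a₂ a₃ b := by
  unfold slopeG0
  have h := T_bL_le_beta_mul p hp ends a₁ a₂ a₃ b
  have h0 : 0 ≤ prob p (avoidAll ends a₂ {a₁} ∩ (connEvent ends a₁ a₃)ᶜ ∩ connEvent ends a₂ b) :=
    prob_nonneg hp _
  linarith

omit [Fintype V] [DecidableEq V] in
/-- **Harris on the two decreasing events `Q` and `{a₃ ∉ C₁}`**: `P(Q) · D₀ ≤ P(Q, a₃ ∉ C₁)` — on `Q`,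
`P(Q, a₃ ∉ C₁) = P(PD) + P(T)`, so `D − Q·D₀ ≥ −P(T)`. -/
theorem Q_mul_D0_le (p : E → R) (hp : IsProbVec p) (ends : E → Sym2 V) (a₁ a₂ a₃ : V) :
    prob p (avoidAll ends a₂ {a₁}) * D0 p ends a₁ a₃ ≤
      prob p (avoidAll ends a₂ {a₁} ∩ avoidAll ends a₁ {a₃}) := by
  unfold D0
  exact prob_mul_prob_le_prob_inter_of_isLowerSet hp (isLowerSet_avoidAll_singleton' ends a₂ a₁)
    (isLowerSet_avoidAll_singleton' ends a₁ a₃)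

end Main

end FirstOrder

end CovForm

end Summit.Ventures.PercRepro2
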